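import Mathlib
import Summits.NavierStokesRegularity.NavierStokesRegularity.Theorems.EulerZoomLiouvillePowerGaugeEulerLiouvilleHoopRunFreeContradiction
import Summits.NavierStokesRegularity.NavierStokesRegularity.Theorems.EulerZoomLiouvillePowerGaugeEulerLiouvilleHoopRunFreeDefs
import Summits.NavierStokesRegularity.NavierStokesRegularity.Theorems.EulerZoomLiouvillePowerGaugeEulerLiouvilleHoopLateral
import Summits.NavierStokesRegularity.NavierStokesRegularity.Theorems.EulerZoomLiouvillePowerGaugeEulerLiouvilleEnergyTail
import Summits.NavierStokesRegularity.NavierStokesRegularity.Theorems.EulerZoomLiouvillePowerGaugeEulerLiouvilleLastExitCriticalSpikes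
import HarnessLib

/-!
# «NO LONG STRAIGHT THIN-WALLED SLOW ∧ HIGH RUNS WITH QUIET ENDS» — THE K-TJ″ MEMBER (alt 8′; hoop line)

Crux `EulerZoomLiouville.PowerGaugeEulerLiouville` = stmt-NavierStokesRegularity-19832 (a crux CLASS of self-similar Euler/NS strata on the
MODEL lattice — not NS regularity, not E).  Width seat ns-ezl-w3 g7 (alt 8′ file (M′); LEAD 19832 ns-typeII-p2 g15 keys 04:09:19Z/04:16:26Z;
face `HasStraightSlowHighRunsFree` = nsreg-p2 g40 ROUND-50 §3 `r50/TJfree_Q.lean`, landed by the LEAD), `--supports stmt-NavierStokesRegularity-19832 --as helper`.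

`Loc.selfSimilar_ae_eq_zero_of_straightSlowHighRunsFreeC2_profile` — binders EXACTLY those of `StraightSlowHighRunsFreeMember`: as alt 8
(`…HoopStraightRunMember`) but with the wall-speed clause, the interior-speed clause and the budget constant REMOVED from the face
(speed `≤ KR` on the two END DISCS only; constraint `4K² + 4K < Λ(½γ(1−γ) − ½λ² − η)`).  Proof: classical pressure `P′`; the FINITE weighted
energy of the class (`NeedleThinCore.selfSimilar_needle_inputs` (E)) ⇒ the E-TAIL `∫⁻_{R≤‖y‖≤2R}‖DV‖ₑ² ≤ εR^{1−ρ}` for `R ≥ R₁(ε)`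
(`Condenser.energyTail`, LEAD t53-ET) at `ε = δ/4`; `R₀ = max(1, R₁, 8K/δ)`; one run; the lateral hoop inequality for the moved field
(`HoopCore.lateralHoopInequality`, LEAD t53-LEL); `HoopCore.false_of_straightSlowHighRunFree` (M0′).

HONEST FRAME / WHAT THIS IS NOT: a member-level stratum — kills ONLY the «straight, thin-walled (ambient circle-mean pressure at radius b),
slow∧high run ≥ Λ(K,λ,η)·b with end-disc speed ≤ KR» face (kinked b-chains, fat ridges, pressurised walls, kinetic spines, spikes untouched);
not NS, not E; 19832 OPEN; NS regularity NOT proved.  [nsreg-p2 g40 ROUND-50 §3; ns-idea-11 g8 HOOP NOTE §10(a); ConstantinIgnatovaVicol2026Putative §3]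
-/

noncomputable section

set_option linter.dupNamespace false

open Set Filter Topology Metric MeasureTheory Function
open scoped RealInnerProductSpace ENNReal NNReal

namespace Summit.NavierStokesRegularity.NavierStokesRegularity.Theorems.PowerGaugeEulerLiouville

open Literature.Analysis Literature.Analysis.FluidPDE

/-- **«NO LONG STRAIGHT THIN-WALLED SLOW ∧ HIGH RUNS WITH QUIET ENDS» MEMBER (centred; K-TJ″, alt 8′).**  An exactly self-similar member of the
crux class (`0 < ρ ≤ ½`, crux hypotheses verbatim) with a `C²` velocity profile satisfying `HasStraightSlowHighRunsFree ρ V` is trivial.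
Binders = `StraightSlowHighRunsFreeMember`. [nsreg-p2 g40 ROUND-50 §3; ns-idea-11 g8 HOOP NOTE §10(a)] -/
theorem Loc.selfSimilar_ae_eq_zero_of_straightSlowHighRunsFreeC2_profile {ρ : ℝ} (hρ : 0 < ρ) (hρ1 : ρ ≤ 1 / 2)
    {u : ℝ → EuclideanSpace ℝ (Fin 3) → EuclideanSpace ℝ (Fin 3)} {p : ℝ → EuclideanSpace ℝ (Fin 3) → ℝ}
    {H : ℝ → EuclideanSpace ℝ (Fin 3) → EuclideanSpace ℝ (Fin 3) →L[ℝ] EuclideanSpace ℝ (Fin 3)} {c : ℝ≥0}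
    (hsw : IsSuitableWeakSolutionOn (slab (EuclideanSpace ℝ (Fin 3)) (Iio 0) isOpen_Iio) 0 0 u p)
    (hH : HasWeakSpatialGradientOn (slab (EuclideanSpace ℝ (Fin 3)) (Iio 0) isOpen_Iio) u H)
    (hgauge : ∀ a : ℝ, 0 < a →
      ENNReal.ofReal (a ^ (2 * ρ)) * cknA a (0 : ℝ × EuclideanSpace ℝ (Fin 3)) u +
          ENNReal.ofReal (a ^ ρ) * cknE a (0 : ℝ × EuclideanSpace ℝ (Fin 3)) H +
        ENNReal.ofReal (a ^ (2 * ρ)) * cknD a (0 : ℝ × EuclideanSpace ℝ (Fin 3)) p ≤ (c : ℝ≥0∞))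
    {V : EuclideanSpace ℝ (Fin 3) → EuclideanSpace ℝ (Fin 3)} {P : EuclideanSpace ℝ (Fin 3) → ℝ}
    (hu : ∀ τ : ℝ, τ < 0 → u τ = selfSimilarCollapse (1 / (2 + ρ)) 0 V τ)
    (hp : ∀ τ : ℝ, τ < 0 → p τ = selfSimilarCollapsePressure (1 / (2 + ρ)) 0 P τ)
    (hV : ContDiff ℝ 2 V)
    (hQ : HasStraightSlowHighRunsFree ρ V) :
    uncurry u =ᵐ[volume.restrict (Iio (0 : ℝ) ×ˢ (univ : Set (EuclideanSpace ℝ (Fin 3))))] 0 := by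
  have hρ1' : ρ < 1 := by linarith
  have h2ρ : (0 : ℝ) < 2 + ρ := by linarith
  have h1ρ : 0 ≤ 1 - ρ := by linarith
  -- ### a classical pressure for the profile (as in K-SPIKE)
  have hD : ∀ a : ℝ, 0 < a → ENNReal.ofReal (a ^ (2 * ρ)) *
      cknD a (0 : ℝ × EuclideanSpace ℝ (Fin 3)) p ≤ (c : ℝ≥0∞) :=
    fun a ha => le_trans le_add_self (hgauge a ha)
  have hpm : AEStronglyMeasurable (uncurry p)
      (volume.restrict (Iio (0 : ℝ) ×ˢ (univ : Set (EuclideanSpace ℝ (Fin 3))))) := by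
    have := hsw.distributional.2.2.1.aestronglyMeasurable
    simpa [slab] using this
  have hPm := aestronglyMeasurable_pressureProfile hpm hp
  have hDprof := profile_pressure_weight_of_gaugeD hρ hρ1' hpm hp hD
  have hP1 : LocallyIntegrable P volume :=
    EnergySaturation.locallyIntegrable_pressure_of_weight hρ1' hPm
      (ENNReal.mul_ne_top ENNReal.ofReal_ne_top ENNReal.coe_ne_top) hDprof
  obtain ⟨P', hprof⟩ :=
    WeakToClassical.exists_isSelfSimilarEulerProfile_of_contDiff hsw.distributional hu hp hV hP1
  have hV1 : ContDiff ℝ 1 V := hV.of_le one_le_two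
  -- ### the finite weighted energy of the class and its tail
  obtain ⟨-, hE'⟩ :=
    NeedleThinCore.selfSimilar_needle_inputs hρ hρ1' hsw hH hgauge hu hp hV1
  have hEfin : (∫⁻ y, ‖fderiv ℝ V y‖ₑ ^ 2 * ENNReal.ofReal (‖y‖ ^ (ρ - 1))) ≠ ⊤ :=
    ne_top_of_le_ne_top ENNReal.ofReal_ne_top hE'
  -- ### the face: constants, margin `δ`, tail radius at `ε = δ/4`, a radius beyond which `2K R^{−(2+ρ)} ≤ δ/4`, one run
  obtain ⟨Λ, lam, η, K, hΛ, -, -, hK, hface, hrun⟩ := hQ P' hprof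
  set δ : ℝ := Λ * ((1 / (2 + ρ)) * (1 - 1 / (2 + ρ)) / 2 - lam ^ 2 / 2 - η) - (4 * K ^ 2 + 4 * K) with hδdef
  have hδ : 0 < δ := by rw [hδdef]; linarith
  obtain ⟨R₁, hR₁⟩ := Condenser.energyTail ρ hρ1' V hV1 hEfin (δ / 4) (by positivity)
  obtain ⟨A, a, R, s₁, s₂, h, hR₀R, hR1, hlen, htube, haxis⟩ := hrun (max (max 1 R₁) (8 * K / δ))
  have hR0 : 0 < R := by linarith
  have hRR₁ : R₁ ≤ R := le_trans (le_trans (le_max_right _ _) (le_max_left _ _)) hR₀R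
  have hER := hR₁ R hRR₁
  have hsmall : δ / 4 + 2 * K * R ^ (-(2 + ρ)) ≤ δ / 2 := by
    have h1 : R ^ (-(2 + ρ)) ≤ R ^ (-(1 : ℝ)) := Real.rpow_le_rpow_of_exponent_le hR1 (by linarith)
    have h2 : R ^ (-(1 : ℝ)) = 1 / R := by rw [Real.rpow_neg hR0.le, Real.rpow_one, one_div]
    have h3 : 2 * K * R ^ (-(2 + ρ)) ≤ 2 * K * (1 / R) := mul_le_mul_of_nonneg_left (h1.trans h2.le) (by positivity)
    have h4 : 8 * K / δ ≤ R := le_trans (le_max_right _ _) hR₀R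
    have h5 : 2 * K * (1 / R) ≤ δ / 4 := by
      rw [mul_one_div, div_le_div_iff₀ hR0 (by norm_num : (0:ℝ) < 4)]
      rw [div_le_iff₀ hδ] at h4
      linarith
    linarith
  have hsmall' : δ / 4 + 2 * K * R ^ (-(2 + ρ)) ≤
      (Λ * ((1 / (2 + ρ)) * (1 - 1 / (2 + ρ)) / 2 - lam ^ 2 / 2 - η) - (4 * K ^ 2 + 4 * K)) / 2 := by
    rw [← hδdef]; exact hsmall
  -- ### the lateral hoop inequality for the moved field on the model cylinder
  have hb : 0 < R ^ (-(1 + ρ)) := Real.rpow_pos_of_pos hR0 _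
  have hs : s₁ < s₂ := by nlinarith [mul_pos hΛ hb]
  have hprof' := HoopCore.isSelfSimilarEulerProfile_rigid hprof A a
  have hlat := HoopCore.lateralHoopInequality (fun y => A.symm (V (A y + a))) s₁ s₂ (R ^ (-(1 + ρ))) hs hb
    (hprof'.contDiff_velocity.of_le (by norm_num)) hprof'.divFree
  exact (HoopCore.false_of_straightSlowHighRunFree hρ hρ1 hprof hΛ hK (by positivity : (0:ℝ) ≤ δ / 4) hface hR1 hlen htube haxis
    hER hlat hsmall').elim

end Summit.NavierStokesRegularity.NavierStokesRegularity.Theorems.PowerGaugeEulerLiouville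

end
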